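import Summits.ResolutionOfSingularities.ResolutionOfSingularities.Theorems.WildQuotientsSummitReductionOfDeJong1997Theorem59ReductionStep
import HarnessLib

/-!
# Crux `WildQuotients.SummitReduction` (stmt-ResolutionOfSingularities-16324) — line `FramePerfect`,
# CLOSED MODULO ONE NAMED FACT: `SummitReduction` from de Jong 1997, Thm. 5.9 (relative dimension 1)
# (part 3/6 — the blocks of Prop. 5.11 assembled from the landed stubs: hB (the one-orbit blow-up Claim of de Jong 1996, 3.4 from C1–C3), A (equivariant Lemma 3.2), O3/S (the orbit version of Claim 4.27 from NB1, NB2), B (3.5 + 4.25–4.28 equivariant from N, S))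

Route `ResolutionOfSingularities/WildQuotients`, crux `SummitReduction` (stmt-ResolutionOfSingularities-16324):
one part of the line skeleton `Cruxes/SummitReduction/Lines/FramePerfect.lean` (v12, lead prover c4) with its
one remaining stub — the Literature NAMED FACT `DeJong1997_quasiSplitSemiStableCurveFibration` (de Jong
1997, Thm. 5.9 in relative dimension 1) — turned into the hypothesis `h59`; the story, the map of the ~115
landed helper files and the conditional crux `summitReduction_of_deJong1997Theorem59` are in the last part,
`WildQuotientsSummitReductionOfDeJong1997Theorem59.lean`. [cite: DeJong1997, Thm. 5.9, Prop. 5.11, Thm. 5.13, pp. 613–620]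
[cite: DeJong1996, 3.2–3.5, 4.23–4.28, 7.1–7.3, pp. 62–65, 75–76, 87–88]
-/

set_option linter.dupNamespace false

noncomputable section

open CategoryTheory CategoryTheory.Limits AlgebraicGeometry TopologicalSpace
open Literature.AlgebraicGeometry.Resolution Literature.AlgebraicGeometry.RelativeSpec
open Literature.AlgebraicGeometry.Motives (RatFn.functionFieldMap RatFn.functionFieldMap_comp)
open Literature.AlgebraicGeometry

namespace Summit.ResolutionOfSingularities.ResolutionOfSingularities.Theorems

/-! ## hT LANDED (p139268): `stub_pair_nodeThickness` is imported from
`…StubPairNodeThickness` (de Jong 1996, 3.3–3.4: `2 ≤ n(x) < ∞`, any field, quasi-split). -/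

/-! ## Stubs C1–C3 (next layer of hB, v8): de Jong 1996, 3.4 Claim OVER THE CENTRE `cl(G · x)`

The hB worker (wave 3) proved everything in the Claim that happens off the exceptional locus
(`…StubPairOrbitBlowupClaimLemmas`, `…OfCentre`, p140003/p140232): hB is
`⟨core.1, quasiSplit_comp_of_isBlowup_vanishingIdeal …, core.2⟩` given six statements (H1)–(H6) at
the points OVER `Z = cl(G · x)`, read in print off the three charts of the blow-up of
`B' = A⟦u, v⟧/(uv - t₁^{n₁} ⋯ t_r^{n_r})` in `(u, v, t₁)` (de Jong 1996, p. 64). As `D` is `G`-strict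
and `f` quasi-split, `cl(G · x)` is a DISJOINT union of translates `ρ(g) cl{x}`, each mapping
isomorphically onto a component of `D` (de Jong 1997, proof of 5.11 ¶1), so locally on `X` the
centre is the closure of ONE codimension-2 singular point and the blow-up localises
(`IsBlowup.restrict`, `IsBlowup.comp_iso`): each stub is the any-field quasi-split form of a tree
theorem for one component over an algebraically closed field. Binders: those of hB. -/

-- C1 LANDED (p145250): `stub_pair_orbitBlowupCentreFlat` is imported from `…StubPairOrbitBlowupCentreFlat`.


-- C2 LANDED (p158319): `stub_pair_orbitBlowupCentreLocal` is imported from `…StubPairOrbitBlowupCentreLocal`.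


-- C3 LANDED (p145857): `stub_pair_orbitBlowupCentreNew` is imported from `…StubPairOrbitBlowupCentreNew`.


/-! ## hB, proved modulo C1–C3: the Claim of de Jong 1996, 3.4 for one orbit blow-up -/

/-- **De Jong 1996, 3.4, the Claim (ii)–(iii) for ONE blow-up of the reduced orbit closure
`cl(G · x)`** of a codimension-2 singular point of a `G`-semi-stable pair of the line, with (iv)
quasi-splitness upstairs (v7's `stub_pair_orbitBlowupClaim`, same signature): from C1–C3 by the hB
worker's landed `stub_pair_orbitBlowupClaim_core_of_centre` and
`quasiSplit_comp_of_isBlowup_vanishingIdeal` (p140232: off `cl(G · x)` the blow-up is a local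
isomorphism over `Y`). [cite: DeJong1996, 3.4, pp. 63–64] [cite: DeJong1997, proof of Prop. 5.11, p. 618] -/
theorem pair_orbitBlowupClaim (k : Type) [Field k] (Y : Scheme.{0}) [IsIntegral Y]
    (q : Y ⟶ Spec (.of k)) (hprojY : Motives.IsProjectiveOver (Over.mk q))
    (hreg : Scheme.IsRegular Y) (D : Set Y)
    (hD : IsStrictNormalCrossingsDivisor Y D) (G : Type) [Group G] [Finite G] (ρY : G →* Aut Y)
    (hDG : (∀ g : G, (ρY g).hom.base '' D = D))
    (hDstrict : (∀ (g : G) (C : Set Y), Maximal (fun C : Set Y => IsIrreducible C ∧ C ⊆ D) C →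
        (C ∩ (ρY g).hom.base '' C).Nonempty → (ρY g).hom.base '' C = C))
    (X : Scheme.{0}) [IsIntegral X] (f : X ⟶ Y) (ρX : G →* Aut X)
    (hprojX : Motives.IsProjectiveOver (Over.mk (f ≫ q)))
    (hρf : ∀ g : G, (ρX g).hom ≫ f = f ≫ (ρY g).hom) (hss : IsSemiStableCurve f)
    (hqs : (∀ x : X, (¬ ∃ U : X.Opens, x ∈ U ∧ Smooth (U.ι ≫ f)) →
        ∃ e : AdicCompletion
            ((IsLocalRing.maximalIdeal (X.presheaf.stalk x)).map (Ideal.Quotient.mk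
              ((IsLocalRing.maximalIdeal (Y.presheaf.stalk (f.base x))).map (f.stalkMap x).hom)))
            (X.presheaf.stalk x ⧸
              (IsLocalRing.maximalIdeal (Y.presheaf.stalk (f.base x))).map (f.stalkMap x).hom) ≃+*
          MvPowerSeries (Fin 2) (Y.presheaf.stalk (f.base x) ⧸ IsLocalRing.maximalIdeal (Y.presheaf.stalk (f.base x))) ⧸
            Ideal.span {(MvPowerSeries.X 0 * MvPowerSeries.X 1 :
              MvPowerSeries (Fin 2) (Y.presheaf.stalk (f.base x) ⧸ IsLocalRing.maximalIdeal (Y.presheaf.stalk (f.base x))))},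
          e.toRingHom.comp ((algebraMap (X.presheaf.stalk x ⧸
              (IsLocalRing.maximalIdeal (Y.presheaf.stalk (f.base x))).map (f.stalkMap x).hom) _).comp
            (Ideal.quotientMap ((IsLocalRing.maximalIdeal (Y.presheaf.stalk (f.base x))).map (f.stalkMap x).hom)
              (f.stalkMap x).hom Ideal.le_comap_map)) =
          algebraMap (Y.presheaf.stalk (f.base x) ⧸ IsLocalRing.maximalIdeal (Y.presheaf.stalk (f.base x))) _))
    (hsm : Smooth (f ∣_ ⟨Dᶜ, hD.isClosed.isOpen_compl⟩))
    (x : X) (hx : x ∈ Scheme.singularLocusCodimLE X 2) (X₁ : Scheme.{0}) (π : X₁ ⟶ X)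
    (hπ : IsBlowup π (Scheme.IdealSheafData.vanishingIdeal
      ⟨closure (Set.range fun g : G => (ρX g).hom.base x), isClosed_closure⟩)) :
    IsSemiStableCurve (π ≫ f) ∧
    (∀ x : X₁, (¬ ∃ U : X₁.Opens, x ∈ U ∧ Smooth (U.ι ≫ (π ≫ f))) →
        ∃ e : AdicCompletion
            ((IsLocalRing.maximalIdeal (X₁.presheaf.stalk x)).map (Ideal.Quotient.mk
              ((IsLocalRing.maximalIdeal (Y.presheaf.stalk ((π ≫ f).base x))).map ((π ≫ f).stalkMap x).hom)))
            (X₁.presheaf.stalk x ⧸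
              (IsLocalRing.maximalIdeal (Y.presheaf.stalk ((π ≫ f).base x))).map ((π ≫ f).stalkMap x).hom) ≃+*
          MvPowerSeries (Fin 2) (Y.presheaf.stalk ((π ≫ f).base x) ⧸ IsLocalRing.maximalIdeal (Y.presheaf.stalk ((π ≫ f).base x))) ⧸
            Ideal.span {(MvPowerSeries.X 0 * MvPowerSeries.X 1 :
              MvPowerSeries (Fin 2) (Y.presheaf.stalk ((π ≫ f).base x) ⧸ IsLocalRing.maximalIdeal (Y.presheaf.stalk ((π ≫ f).base x))))},
          e.toRingHom.comp ((algebraMap (X₁.presheaf.stalk x ⧸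
              (IsLocalRing.maximalIdeal (Y.presheaf.stalk ((π ≫ f).base x))).map ((π ≫ f).stalkMap x).hom) _).comp
            (Ideal.quotientMap ((IsLocalRing.maximalIdeal (Y.presheaf.stalk ((π ≫ f).base x))).map ((π ≫ f).stalkMap x).hom)
              ((π ≫ f).stalkMap x).hom Ideal.le_comap_map)) =
          algebraMap (Y.presheaf.stalk ((π ≫ f).base x) ⧸ IsLocalRing.maximalIdeal (Y.presheaf.stalk ((π ≫ f).base x))) _) ∧
    Smooth ((π ≫ f) ∣_ ⟨Dᶜ, hD.isClosed.isOpen_compl⟩) ∧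
    Set.MapsTo π.base (Scheme.singularLocusCodimLE X₁ 2) (Scheme.singularLocusCodimLE X 2) ∧
    Set.InjOn π.base (Scheme.singularLocusCodimLE X₁ 2) ∧
    (∀ x₁ ∈ Scheme.singularLocusCodimLE X₁ 2,
      π.base x₁ ∉ Set.range (fun g : G => (ρX g).hom.base x) →
        Scheme.Hom.nodeThickness (π ≫ f) x₁ = Scheme.Hom.nodeThickness f (π.base x₁)) ∧
    (∀ x₁ ∈ Scheme.singularLocusCodimLE X₁ 2,
      π.base x₁ ∈ Set.range (fun g : G => (ρX g).hom.base x) →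
        Scheme.Hom.nodeThickness (π ≫ f) x₁ + 2 = Scheme.Hom.nodeThickness f x) := by
  obtain ⟨hflat, hconn⟩ := stub_pair_orbitBlowupCentreFlat k Y q hprojY hreg D hD G ρY hDG hDstrict X f ρX hprojX hρf hss hqs hsm x hx X₁ π hπ
  obtain ⟨hqsZ, hnodal⟩ := stub_pair_orbitBlowupCentreLocal k Y q hprojY hreg D hD G ρY hDG hDstrict X f ρX hprojX hρf hss hqs hsm x hx X₁ π hπ
  obtain ⟨hnew, huniq⟩ := stub_pair_orbitBlowupCentreNew k Y q hprojY hreg D hD G ρY hDG hDstrict X f ρX hprojX hρf hss hqs hsm x hx X₁ π hπ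
  have h := stub_pair_orbitBlowupClaim_core_of_centre k Y q hreg D hD G X f ρX hprojX hss hsm x hx X₁ π
    hπ hflat hnodal hconn hnew huniq
  exact ⟨h.1, quasiSplit_comp_of_isBlowup_vanishingIdeal f isClosed_closure hπ hqs hqsZ, h.2⟩

/-! ## A, proved modulo C1–C3: equivariant Lemma 3.2 (landed assembly p137059, landed hT p139268) -/

/-- **De Jong 1996, Lemma 3.2 made `G`-equivariant and quasi-split** (de Jong 1997, proof of
Prop. 5.11 ¶1; v6's `stub_pair_ssCodimThree` with `hprojY` added): from the node thickness bounds
(hT) and the one-orbit blow-up Claim (hB) by the A worker's landed equivariant induction on the number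
of codimension-2 singular orbits (`stub_pair_ssCodimThree_of_thickness_of_orbitBlowup`, p137059).
[cite: DeJong1996, Lemma 3.2 and 3.4, pp. 62–64] [cite: DeJong1997, proof of Prop. 5.11, p. 618] -/
theorem pair_ssCodimThree (k : Type) [Field k] (X Y : Scheme.{0}) [IsIntegral X] [IsIntegral Y]
    (f : X ⟶ Y) (q : Y ⟶ Spec (.of k))
    (hprojX : Motives.IsProjectiveOver (Over.mk (f ≫ q))) (hprojY : Motives.IsProjectiveOver (Over.mk q)) (hreg : Scheme.IsRegular Y)
    (D : Set Y) (hD : IsStrictNormalCrossingsDivisor Y D)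
    (G : Type) [Group G] [Finite G] (ρX : G →* Aut X) (ρY : G →* Aut Y)
    (hρf : (∀ g : G, (ρX g).hom ≫ f = f ≫ (ρY g).hom))
    (hDG : (∀ g : G, (ρY g).hom.base '' D = D))
    (hDstrict : (∀ (g : G) (C : Set Y), Maximal (fun C : Set Y => IsIrreducible C ∧ C ⊆ D) C →
        (C ∩ (ρY g).hom.base '' C).Nonempty → (ρY g).hom.base '' C = C))
    (hss : IsSemiStableCurve f)
    (hqs : (∀ x : X, (¬ ∃ U : X.Opens, x ∈ U ∧ Smooth (U.ι ≫ f)) →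
        ∃ e : AdicCompletion
            ((IsLocalRing.maximalIdeal (X.presheaf.stalk x)).map (Ideal.Quotient.mk
              ((IsLocalRing.maximalIdeal (Y.presheaf.stalk (f.base x))).map (f.stalkMap x).hom)))
            (X.presheaf.stalk x ⧸
              (IsLocalRing.maximalIdeal (Y.presheaf.stalk (f.base x))).map (f.stalkMap x).hom) ≃+*
          MvPowerSeries (Fin 2) (Y.presheaf.stalk (f.base x) ⧸ IsLocalRing.maximalIdeal (Y.presheaf.stalk (f.base x))) ⧸
            Ideal.span {(MvPowerSeries.X 0 * MvPowerSeries.X 1 :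
              MvPowerSeries (Fin 2) (Y.presheaf.stalk (f.base x) ⧸ IsLocalRing.maximalIdeal (Y.presheaf.stalk (f.base x))))},
          e.toRingHom.comp ((algebraMap (X.presheaf.stalk x ⧸
              (IsLocalRing.maximalIdeal (Y.presheaf.stalk (f.base x))).map (f.stalkMap x).hom) _).comp
            (Ideal.quotientMap ((IsLocalRing.maximalIdeal (Y.presheaf.stalk (f.base x))).map (f.stalkMap x).hom)
              (f.stalkMap x).hom Ideal.le_comap_map)) =
          algebraMap (Y.presheaf.stalk (f.base x) ⧸ IsLocalRing.maximalIdeal (Y.presheaf.stalk (f.base x))) _))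
    (hsm : Smooth (f ∣_ ⟨Dᶜ, hD.isClosed.isOpen_compl⟩))
    (m : ℕ) (τ : Fin m → (Y ⟶ X)) (hτf : (∀ i : Fin m, τ i ≫ f = 𝟙 Y))
    (hτdisj : (Pairwise fun i j : Fin m => Disjoint (Set.range (τ i)) (Set.range (τ j))))
    (hτsm : (∀ i : Fin m, ∃ U : X.Opens, Set.range (τ i) ⊆ (U : Set X) ∧ Smooth (U.ι ≫ f)))
    (hτG : (∀ (g : G) (i : Fin m), ∃ j : Fin m, τ i ≫ (ρX g).hom = (ρY g).hom ≫ τ j)) :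
    ∃ (X' : Scheme.{0}) (_ : IsIntegral X') (φ : X' ⟶ X) (ρX' : G →* Aut X')
          (τ' : Fin m → (Y ⟶ X')),
          IsModification φ ∧ (∀ g : G, (ρX' g).hom ≫ φ = φ ≫ (ρX g).hom) ∧ (∀ i : Fin m, τ' i ≫ φ = τ i) ∧
          φ.base ⁻¹' DeJong1996.semiStableBoundary f D τ = DeJong1996.semiStableBoundary (φ ≫ f) D τ' ∧
          (∀ x : X', ¬ IsRegularLocalRing (X'.presheaf.stalk x) →
              (3 : WithBot ℕ∞) ≤ ringKrullDim (X'.presheaf.stalk x)) ∧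
          Motives.IsProjectiveOver (Over.mk ((φ ≫ f) ≫ q)) ∧
          IsSemiStableCurve (φ ≫ f) ∧
          (∀ x : X', (¬ ∃ U : X'.Opens, x ∈ U ∧ Smooth (U.ι ≫ (φ ≫ f))) →
                  ∃ e : AdicCompletion
                      ((IsLocalRing.maximalIdeal (X'.presheaf.stalk x)).map (Ideal.Quotient.mk
                        ((IsLocalRing.maximalIdeal (Y.presheaf.stalk ((φ ≫ f).base x))).map ((φ ≫ f).stalkMap x).hom)))
                      (X'.presheaf.stalk x ⧸
                        (IsLocalRing.maximalIdeal (Y.presheaf.stalk ((φ ≫ f).base x))).map ((φ ≫ f).stalkMap x).hom) ≃+*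
                    MvPowerSeries (Fin 2) (Y.presheaf.stalk ((φ ≫ f).base x) ⧸ IsLocalRing.maximalIdeal (Y.presheaf.stalk ((φ ≫ f).base x))) ⧸
                      Ideal.span {(MvPowerSeries.X 0 * MvPowerSeries.X 1 :
                        MvPowerSeries (Fin 2) (Y.presheaf.stalk ((φ ≫ f).base x) ⧸ IsLocalRing.maximalIdeal (Y.presheaf.stalk ((φ ≫ f).base x))))},
                    e.toRingHom.comp ((algebraMap (X'.presheaf.stalk x ⧸
                        (IsLocalRing.maximalIdeal (Y.presheaf.stalk ((φ ≫ f).base x))).map ((φ ≫ f).stalkMap x).hom) _).comp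
                      (Ideal.quotientMap ((IsLocalRing.maximalIdeal (Y.presheaf.stalk ((φ ≫ f).base x))).map ((φ ≫ f).stalkMap x).hom)
                        ((φ ≫ f).stalkMap x).hom Ideal.le_comap_map)) =
                    algebraMap (Y.presheaf.stalk ((φ ≫ f).base x) ⧸ IsLocalRing.maximalIdeal (Y.presheaf.stalk ((φ ≫ f).base x))) _) ∧
          Smooth ((φ ≫ f) ∣_ ⟨Dᶜ, hD.isClosed.isOpen_compl⟩) ∧
          (∀ i : Fin m, ∃ U : X'.Opens, Set.range (τ' i) ⊆ (U : Set X') ∧ Smooth (U.ι ≫ (φ ≫ f))) ∧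
          (∀ (g : G) (i : Fin m), ∃ j : Fin m, τ' i ≫ (ρX' g).hom = (ρY g).hom ≫ τ' j) :=
  stub_pair_ssCodimThree_of_thickness_of_orbitBlowup k X Y f q hprojX hreg D hD G ρX ρY hρf hDG
    hDstrict hss hqs hsm m τ hτf hτdisj hτsm hτG
    (fun X' _ f' h1 h2 h3 h4 x hx => stub_pair_nodeThickness k Y q hprojY hreg D hD X' f' h1 h2 h3 h4 x hx)
    (fun X' _ f' ρX' h1 h2 h3 h4 h5 x hx X₁ π hπ =>
      pair_orbitBlowupClaim k Y q hprojY hreg D hD G ρY hDG hDstrict X' f' ρX' h1 h2 h3 h4 h5 x hx X₁ π hπ)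

/-! ## Stubs N, S (next layer of B, v8) and B proved from them over a PERFECT field

The B worker (wave 3) DEFINED the invariant of de Jong's equivariant orbit blow-up iteration in
Literature (`DeJong1997.QuasiSplitNormalFormPair`, p139488: de Jong 1996 Situation 4.25 without
coefficient field and with `G`-orbits of singular components), proved the end of the iteration and
the centre bookkeeping, the formal/étale comparison of normal crossings over a perfect field
(p139813), and B from the two statements below (`stub_pair_ssOrbitBlowup_of_normalForm_of_orbitClaim`,
p140166) by the landed iteration `ssOrbitBlowup_of_invariant` (p135914/p136105). -/

-- N LANDED (p144595): `stub_pair_quasiSplitNormalForm` is imported from `…StubPairQuasiSplitNormalForm`.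


-- NB1 LANDED (p158187): `stub_pair_orbitNormalFormBlowup_modelSingularOverCentre` is imported from
-- `…StubPairOrbitNormalFormBlowupModelSingularOverCentre`.


-- NB2 LANDED (p171745): `stub_pair_orbitNormalFormBlowup_modelChartsOverCentre` is imported from
-- `…StubPairOrbitNormalFormBlowupModelChartsOverCentre`.


/-- **O3 (v9–v10's `stub_pair_orbitNormalFormBlowup_chartsOverCentre`, same signature) PROVED
modulo NB2** by the O3 worker's landed transfer `X' ↔ X' ×_X Spec 𝒪̂_{X,x} → Spec(model)`
(`stub_pair_orbitNormalFormBlowup_chartsOverCentre_of_model`, p154033 with p152753/p153904).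
[cite: DeJong1996, 4.27, pp. 75–76] [cite: DeJong1997, proof of Prop. 5.11, p. 619] -/
theorem pair_orbitNormalFormBlowup_chartsOverCentre (k : Type) [Field k] [PerfectField k] (G : Type) [Group G] [Finite G]
    (X : Scheme.{0}) (p : X ⟶ Spec (.of k)) (ρ : G →* Aut X) (Z : Set X) (d : ℕ)
    (hP : DeJong1997.QuasiSplitNormalFormPair p Z ρ d)
    (E : Set ↥({x : X | ¬ IsRegularLocalRing (X.presheaf.stalk x)} : Set X))
    (hE : E ∈ irreducibleComponents ↥({x : X | ¬ IsRegularLocalRing (X.presheaf.stalk x)} : Set X))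
    (X' : Scheme.{0}) (π : X' ⟶ X) (ρ' : G →* Aut X')
    (hπ : IsBlowup π (Scheme.IdealSheafData.vanishingIdeal
      ⟨closure (⋃ g : G, (ρ g).hom.base '' (Subtype.val '' E)), isClosed_closure⟩))
    (hπG : ∀ g : G, (ρ' g).hom ≫ π = π ≫ (ρ g).hom)
    (hproj' : Motives.IsProjectiveOver (Over.mk (π ≫ p))) :
    (∀ x' : X', IsClosed ({x'} : Set X') → ∀ [IsRegularLocalRing (X'.presheaf.stalk x')],
      x' ∈ π.base ⁻¹' Z → π.base x' ∈ closure (⋃ g : G, (ρ g).hom.base '' (Subtype.val '' E)) →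
        ∀ (U : X'.affineOpens) (hU : x' ∈ (U : X'.Opens)),
          IsSNCIdeal (completedStalkIdeal (Scheme.IdealSheafData.vanishingIdeal
            ⟨π.base ⁻¹' Z, hP.isClosed.preimage π.continuous⟩) x' U hU)) ∧
    (∀ x' : X', IsClosed ({x'} : Set X') → ¬ IsRegularLocalRing (X'.presheaf.stalk x') →
      π.base x' ∈ closure (⋃ g : G, (ρ g).hom.base '' (Subtype.val '' E)) →
        ∃ (A : Type) (_ : CommRing A) (_ : IsRegularLocalRing A) (t : Fin (d - 1) → A) (s r : ℕ),
          Ideal.span (Set.range t) = IsLocalRing.maximalIdeal A ∧ ringKrullDim A = (d - 1 : ℕ) ∧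
          2 ≤ s ∧ s ≤ r ∧ r ≤ d - 1 ∧
          ∃ e : AdicCompletion (IsLocalRing.maximalIdeal (X'.presheaf.stalk x'))
              (X'.presheaf.stalk x') ≃+*
              DeJong1996.NodeDeformationRing A
                (∏ i ∈ Finset.univ.filter (fun i : Fin (d - 1) => i.val < s), t i),
            ∀ (U : X'.affineOpens) (hU : x' ∈ (U : X'.Opens)),
              (completedStalkIdeal (Scheme.IdealSheafData.vanishingIdeal
                  ⟨π.base ⁻¹' Z, hP.isClosed.preimage π.continuous⟩) x' U hU).map e.toRingHom =
                Ideal.span {DeJong1996.NodeDeformationRing.ofBase A _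
                  (∏ i ∈ Finset.univ.filter (fun i : Fin (d - 1) => i.val < r), t i)}) :=
  stub_pair_orbitNormalFormBlowup_chartsOverCentre_of_model k G X p ρ Z d hP E hE X' π ρ' hπ hπG hproj'
    stub_pair_orbitNormalFormBlowup_modelChartsOverCentre


/-- **S (the orbit version of de Jong 1996, Claim 4.27; v8's `stub_pair_orbitNormalFormBlowup`,
same signature) PROVED modulo NB1 and O3** by the S worker's landed reduction: orbit centre =
disjoint union of translates (p141692), the count through strict transforms (p141695), the clauses
off the centre (p141697), the coefficient-free singular locus of the model and the formal ideal of
the centre (p142031/p142082/p143451/p144274), O2 = regularity of the strict transforms of the other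
orbits (p144431), O1 from NB1 (p144494), assembly `quasiSplitNormalFormPair_blowup_of_overCentre`
(p142026). [cite: DeJong1996, 4.27, pp. 75–76] [cite: DeJong1997, proof of Prop. 5.11, p. 619] -/
theorem pair_orbitNormalFormBlowup (k : Type) [Field k] [PerfectField k] (G : Type) [Group G] [Finite G]
    (X : Scheme.{0}) (p : X ⟶ Spec (.of k)) (ρ : G →* Aut X) (Z : Set X) (d : ℕ)
    (hP : DeJong1997.QuasiSplitNormalFormPair p Z ρ d)
    (E : Set ↥({x : X | ¬ IsRegularLocalRing (X.presheaf.stalk x)} : Set X))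
    (hE : E ∈ irreducibleComponents ↥({x : X | ¬ IsRegularLocalRing (X.presheaf.stalk x)} : Set X))
    (X' : Scheme.{0}) (π : X' ⟶ X) (ρ' : G →* Aut X')
    (hπ : IsBlowup π (Scheme.IdealSheafData.vanishingIdeal
      ⟨closure (⋃ g : G, (ρ g).hom.base '' (Subtype.val '' E)), isClosed_closure⟩))
    (hπG : ∀ g : G, (ρ' g).hom ≫ π = π ≫ (ρ g).hom)
    (hproj' : Motives.IsProjectiveOver (Over.mk (π ≫ p))) :
    DeJong1997.QuasiSplitNormalFormPair (π ≫ p) (π.base ⁻¹' Z) ρ' d ∧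
      (irreducibleComponents
          ↥({x : X' | ¬ IsRegularLocalRing (X'.presheaf.stalk x)} : Set X')).ncard <
        (irreducibleComponents
          ↥({x : X | ¬ IsRegularLocalRing (X.presheaf.stalk x)} : Set X)).ncard :=
  quasiSplitNormalFormPair_blowup_of_overCentre k G X p ρ Z d hP E hE X' π ρ' hπ hπG hproj'
    (stub_pair_orbitNormalFormBlowup_singularOverCentre_of_model k G X p ρ Z d hP E hE X' π hπ
      stub_pair_orbitNormalFormBlowup_modelSingularOverCentre)
    (stub_pair_orbitNormalFormBlowup_strictTransformOrbitRegular k G X p ρ Z d hP E hE X' π hπ)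
    (pair_orbitNormalFormBlowup_chartsOverCentre k G X p ρ Z d hP E hE X' π ρ' hπ hπG hproj').1
    (pair_orbitNormalFormBlowup_chartsOverCentre k G X p ρ Z d hP E hE X' π ρ' hπ hπG hproj').2


/-- **B over a perfect field** (v7's `stub_pair_ssOrbitBlowup` with `[PerfectField k]`, which the
line's induction `pair_statementUpToDim` supplies): de Jong 1996, 3.5 + 4.25–4.28 made
`G`-equivariant (de Jong 1997, 5.11 ¶2–3), from N and S by the B worker's landed reduction
`stub_pair_ssOrbitBlowup_of_normalForm_of_orbitClaim` (p140166). [cite: DeJong1996, 3.5, 4.25–4.28, pp. 64, 75–76]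
[cite: DeJong1997, proof of Prop. 5.11, p. 619] -/
theorem pair_ssOrbitBlowup (k : Type) [Field k] [PerfectField k] (X Y : Scheme.{0}) [IsIntegral X] [IsIntegral Y]
    (f : X ⟶ Y) (q : Y ⟶ Spec (.of k))
    (hprojX : Motives.IsProjectiveOver (Over.mk (f ≫ q))) (hprojY : Motives.IsProjectiveOver (Over.mk q)) (hreg : Scheme.IsRegular Y)
    (D : Set Y) (hD : IsStrictNormalCrossingsDivisor Y D)
    (G : Type) [Group G] [Finite G] (ρX : G →* Aut X) (ρY : G →* Aut Y)
    (hρf : (∀ g : G, (ρX g).hom ≫ f = f ≫ (ρY g).hom))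
    (hDG : (∀ g : G, (ρY g).hom.base '' D = D))
    (hDstrict : (∀ (g : G) (C : Set Y), Maximal (fun C : Set Y => IsIrreducible C ∧ C ⊆ D) C →
        (C ∩ (ρY g).hom.base '' C).Nonempty → (ρY g).hom.base '' C = C))
    (hss : IsSemiStableCurve f)
    (hqs : (∀ x : X, (¬ ∃ U : X.Opens, x ∈ U ∧ Smooth (U.ι ≫ f)) →
        ∃ e : AdicCompletion
            ((IsLocalRing.maximalIdeal (X.presheaf.stalk x)).map (Ideal.Quotient.mk
              ((IsLocalRing.maximalIdeal (Y.presheaf.stalk (f.base x))).map (f.stalkMap x).hom)))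
            (X.presheaf.stalk x ⧸
              (IsLocalRing.maximalIdeal (Y.presheaf.stalk (f.base x))).map (f.stalkMap x).hom) ≃+*
          MvPowerSeries (Fin 2) (Y.presheaf.stalk (f.base x) ⧸ IsLocalRing.maximalIdeal (Y.presheaf.stalk (f.base x))) ⧸
            Ideal.span {(MvPowerSeries.X 0 * MvPowerSeries.X 1 :
              MvPowerSeries (Fin 2) (Y.presheaf.stalk (f.base x) ⧸ IsLocalRing.maximalIdeal (Y.presheaf.stalk (f.base x))))},
          e.toRingHom.comp ((algebraMap (X.presheaf.stalk x ⧸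
              (IsLocalRing.maximalIdeal (Y.presheaf.stalk (f.base x))).map (f.stalkMap x).hom) _).comp
            (Ideal.quotientMap ((IsLocalRing.maximalIdeal (Y.presheaf.stalk (f.base x))).map (f.stalkMap x).hom)
              (f.stalkMap x).hom Ideal.le_comap_map)) =
          algebraMap (Y.presheaf.stalk (f.base x) ⧸ IsLocalRing.maximalIdeal (Y.presheaf.stalk (f.base x))) _))
    (hsm : Smooth (f ∣_ ⟨Dᶜ, hD.isClosed.isOpen_compl⟩))
    (m : ℕ) (τ : Fin m → (Y ⟶ X)) (hτf : (∀ i : Fin m, τ i ≫ f = 𝟙 Y))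
    (hτdisj : (Pairwise fun i j : Fin m => Disjoint (Set.range (τ i)) (Set.range (τ j))))
    (hτsm : (∀ i : Fin m, ∃ U : X.Opens, Set.range (τ i) ⊆ (U : Set X) ∧ Smooth (U.ι ≫ f)))
    (hτG : (∀ (g : G) (i : Fin m), ∃ j : Fin m, τ i ≫ (ρX g).hom = (ρY g).hom ≫ τ j))
    (hcodim : (∀ x : X, ¬ IsRegularLocalRing (X.presheaf.stalk x) →
            (3 : WithBot ℕ∞) ≤ ringKrullDim (X.presheaf.stalk x))) :
    ∃ (X' : Scheme.{0}) (_ : IsIntegral X') (ψ : X' ⟶ X) (ρX' : G →* Aut X'),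
          IsModification ψ ∧ (∀ g : G, (ρX' g).hom ≫ ψ = ψ ≫ (ρX g).hom) ∧
          Motives.IsProjectiveOver (Over.mk ((ψ ≫ f) ≫ q)) ∧ Scheme.IsRegular X' ∧
          IsNormalCrossingsDivisor X' (ψ.base ⁻¹' DeJong1996.semiStableBoundary f D τ) :=
  stub_pair_ssOrbitBlowup_of_normalForm_of_orbitClaim stub_pair_quasiSplitNormalForm
    pair_orbitNormalFormBlowup k X Y f q hprojX hprojY hreg D hD G ρX ρY hρf hDG hDstrict hss hqs hsm m τ hτf hτdisj hτsm hτG hcodim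

end Summit.ResolutionOfSingularities.ResolutionOfSingularities.Theorems

end
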